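import Literature.AlgebraicGeometry.HodgeTheory.HodgeTypeExteriorProduct
import Literature.AlgebraicGeometry.HodgeTheory.BettiUniverseCMAction
import Literature.AlgebraicGeometry.HodgeTheory.LefschetzOneOneHolds
import Literature.AlgebraicGeometry.HodgeTheory.AlgebraicClassesHodgeTypeHolds
import Literature.AlgebraicGeometry.HodgeTheory.ClassesSupportedOnComplexification
import Literature.AlgebraicGeometry.HodgeTheory.SupportedClassesRationalProofs
import Literature.AlgebraicGeometry.Motives.HodgeStructureQuotient
import Literature.AlgebraicGeometry.Motives.HodgeStructureDirectSum
import Literature.AlgebraicGeometry.Motives.HodgeStructureProofs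
import HarnessLib

/-!
# Transfer of the weight-two Hodge data along a morphism inducing an isomorphism on `H²`
# (the Lefschetz transfer package for `H²`)

Topic `Literature/AlgebraicGeometry/HodgeTheory` (definitions `H2n`, `pullHom`, `invHom` with bodies;
theorems; no named facts). Promoted from the cell file of route memo ROUTE-P1Z «L-SEC» (cell
`hodge-nonav`, planner seat p1, gens 27–28: `Sketch_P1Z_LSEC_core_g27.lean` §1–§4, kernel-checked
there against the same tree imports), at the planner's request (ask A31), so that the transfer half
of the chapter is importable; the existence half (smooth `σ`-stable sections) is
`HodgeTheory/EquivariantSmoothHyperplaneSection`.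

Setting: `ι : Y ⟶ M` a morphism of smooth projective complex varieties (any dimensions) such that
`ι^* : H²(M(ℂ); ℂ) → H²(Y(ℂ); ℂ)` is BIJECTIVE — e.g. a smooth ample hypersurface section of
dimension `≥ 3` (Lefschetz hyperplane theorem, Voisin II Thm. 1.23; tree
`bijective_complexBettiMap_hypersurfaceSection_of_lt`, `FiniteMorphismSection.bijective_complexBettiMap_fiberι_toX_of_lt`).

* §1 `H2n hX` — the `ℚ`-Hodge structure `H²_B(X)` of a smooth projective `X` of any dimension
  (tree `BettiUniverse.hodge`, weight cast to the literal `2`); its pieces read through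
  `Θ : ℂ ⊗ H²(X(ℂ); ℚ) ⥲ H²(X(ℂ); ℂ)`; `isOfHodgeType_one_one_of_forall` /
  `algebraicClasses_eq_top_of_forall` / **`exists_twoZero_of_finrank_lt`: `ρ(X) < b₂(X)` ⟹ a nonzero
  `(2,0)`-class exists** (Hodge decomposition + Lefschetz `(1,1)`).
* §2 TRANSFER along `ι` with `ι^*` bijective on `H²(–; ℂ)`: bijective on `H²(–; ℚ)` (`pull_bijective`),
  hence an ISOMORPHISM of `ℚ`-Hodge structures (`pullHom`, inverse `invHom` by strictness, Voisin I
  Lemma 7.23 = tree `Hom.inverse`); Hodge types lift and descend (`exists_preimage_isOfHodgeType`,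
  `isOfHodgeType_of_pull`); `N¹H²(Y) = ι^*N¹H²(M)` (`map_algebraicClasses_eq`, Lefschetz `(1,1)` on
  both sides); `ρ(Y) = ρ(M)` (`finrank_algebraicClasses_eq`), `b₂(Y) = b₂(M)`
  (`finrank_complexBetti_eq`); the `(2,0)`-line transfers (`twoZero_transfer`).
* §3 AUTOMORPHISMS: `τ ≫ ι = ι ≫ σ` ⟹ `τ^* ι^* = ι^* σ^*` (`map_map_of_comm`), eigen-relations and
  "moved classes" transfer, `τ^k ≫ ι = ι ≫ σ^k`, and `ι` mono + `σ^k = 𝟙` ⟹ `τ^k = 𝟙`.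
* §4 `kernelInputs` — the package used by the cell's kernel theorem: from a `(2,0)`-line `ℂσ₀` on `M`
  moved by `σ` and `p − 1 = b₂(M) − ρ(M)`, the same data on `Y`.

## References

* [VoisinHodgeI2002] C. Voisin, *Hodge Theory and Complex Algebraic Geometry I*, CUP 2002, §6.1.3
  Cor. 6.12, §7.1.1, §7.3.1 Lemma 7.23, §7.3.2, Thm. 11.30.
* [VoisinHodgeII2003] C. Voisin, *Hodge Theory and Complex Algebraic Geometry II*, CUP 2003,
  Thm. 1.23, §2.3.1.
* [HatcherAT2002] A. Hatcher, *Algebraic Topology*, CUP 2002, §3.1 p. 198.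
* [GrothendieckTopology1969] A. Grothendieck, *Hodge's general conjecture is false for trivial
  reasons*, Topology 8 (1969), pp. 299–300.
-/

noncomputable section

open scoped TensorProduct
open CategoryTheory
open Literature.AlgebraicTopology.SingularHomology
open Literature.AlgebraicGeometry Literature.AlgebraicGeometry.Motives
open Literature.AlgebraicGeometry.Motives.HodgeStructure

namespace Literature.AlgebraicGeometry.HodgeTheory.H2Transfer

/-! ## §1 `H²_B(X)` in any dimension; pieces through `Θ`; `ρ < b₂ ⟹ H^{2,0} ≠ 0` -/

section AnyDim

variable {n : ℕ} {X : SchemeOver ℂ}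

/-- `H²_B(X)` for a smooth projective `X` of dimension `n`: the tree's `BettiUniverse.hodge`, weight cast to the
literal `2`. [cite: VoisinHodgeI2002, §7.1.1] -/
abbrev H2n (hX : IsSmoothProjective n X) : HodgeStructure (bettiCohomology X (2 * 1)) 2 :=
  (BettiUniverse.hodge exists_isReal_hodgeModel_holds hX (2 * 1)).cast (by norm_num)

/-- Pieces of `H²_B(X)` read on `H²(X(ℂ); ℂ)` through `Θ` (`p + q = 2`). [cite: VoisinHodgeI2002, §7.1.1] -/
theorem mem_piece_iff (hX : IsSmoothProjective n X) {p q : ℕ} (hpq : p + q = 2)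
    (x : ℂ ⊗[ℚ] bettiCohomology X (2 * 1)) :
    x ∈ (H2n hX).piece p q ↔ IsOfHodgeType n X (2 * 1) p q (ofRatClassBaseChange (Motives.ComplexPoints X) (2 * 1) x) := by
  have h := BettiUniverse.mem_hodge_piece_iff exists_isReal_hodgeModel_holds
    hodgePQ_independent_of_hodgeModel_holds hX (k := 2 * 1) (p := p) (q := q) (by omega) x
  rw [H2n, cast_piece]
  exact h

/-- The `(2,0)`-piece of `H²_B(X)` read through `Θ`. [cite: VoisinHodgeI2002, §7.1.1] -/
theorem mem_piece_two_zero_iff (hX : IsSmoothProjective n X) (x : ℂ ⊗[ℚ] bettiCohomology X (2 * 1)) :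
    x ∈ (H2n hX).piece 2 0 ↔ IsOfHodgeType n X (2 * 1) 2 0 (ofRatClassBaseChange (Motives.ComplexPoints X) (2 * 1) x) := by
  exact_mod_cast mem_piece_iff hX (p := 2) (q := 0) rfl x

/-- The `(1,1)`-piece of `H²_B(X)` read through `Θ`. [cite: VoisinHodgeI2002, §7.1.1] -/
theorem mem_piece_one_one_iff (hX : IsSmoothProjective n X) (x : ℂ ⊗[ℚ] bettiCohomology X (2 * 1)) :
    x ∈ (H2n hX).piece 1 1 ↔ IsOfHodgeType n X (2 * 1) 1 1 (ofRatClassBaseChange (Motives.ComplexPoints X) (2 * 1) x) := by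
  exact_mod_cast mem_piece_iff hX (p := 1) (q := 1) rfl x

/-- `F^r H²_B(X) = 0` for `r > 2`. [cite: VoisinHodgeI2002, §7.1.1] -/
theorem F_eq_bot_of_lt (hX : IsSmoothProjective n X) {r : ℤ} (hr : 2 < r) : (H2n hX).F r = ⊥ := by
  show (BettiUniverse.hodge exists_isReal_hodgeModel_holds hX (2 * 1)).F r = ⊥
  rw [BettiUniverse.hodge_F]
  exact HodgeModel.ratF_eq_bot _ hX (2 * 1) (by push_cast; omega)

/-- **If `X` has no nonzero `(2,0)`-class, every class of `H²(X(ℂ); ℂ)` is of type `(1,1)`** (Hodge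
decomposition `H² = H^{2,0} ⊕ H^{1,1} ⊕ H^{0,2}` and Hodge symmetry). [cite: VoisinHodgeI2002, §6.1.3 Cor. 6.12] -/
theorem isOfHodgeType_one_one_of_forall (hX : IsSmoothProjective n X)
    (h : ∀ c : complexBetti X (2 * 1), IsOfHodgeType n X (2 * 1) 2 0 c → c = 0) (c : complexBetti X (2 * 1)) :
    IsOfHodgeType n X (2 * 1) 1 1 c := by
  obtain ⟨x, rfl⟩ := ofRatClassBaseChange_surjective hX (2 * 1) c
  rw [← mem_piece_one_one_iff hX]
  have h20 : (H2n hX).piece 2 0 = ⊥ := by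
    refine eq_bot_iff.2 fun t ht ↦ ?_
    rw [mem_piece_two_zero_iff hX] at ht
    have := h _ ht
    rw [Submodule.mem_bot]
    exact ofRatClassBaseChange_injective _ _ (by rw [this, map_zero])
  have h02 : (H2n hX).piece 0 2 = ⊥ := by
    rw [← complexConj_piece (H2n hX) 2 0, h20, complexConj_bot]
  have htop := iSup_piece_eq_top_holds (H2n hX)
  have hx : x ∈ ⨆ p : ℤ, (H2n hX).piece p (2 - p) := by rw [htop]; exact Submodule.mem_top
  suffices hle : (⨆ p : ℤ, (H2n hX).piece p (2 - p)) ≤ (H2n hX).piece 1 1 from hle hx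
  refine iSup_le fun p ↦ ?_
  rcases lt_trichotomy p 1 with hp | rfl | hp
  · rcases eq_or_lt_of_le (Int.le_sub_one_of_lt hp) with hp0 | hp'
    · have hp00 : p = 0 := by omega
      subst hp00
      rw [show (2 : ℤ) - 0 = 2 by norm_num, h02]
      exact bot_le
    · refine (HodgeStructure.piece_le_complexConj_F _ _ _).trans ?_
      rw [F_eq_bot_of_lt hX (by omega), complexConj_bot]
      exact bot_le
  · rw [show (2 : ℤ) - 1 = 1 by norm_num]
  · rcases eq_or_lt_of_le (Int.add_one_le_of_lt hp) with h2 | hp'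
    · have hp2 : p = 2 := by omega
      subst hp2
      rw [show (2 : ℤ) - 2 = 0 by norm_num, h20]
      exact bot_le
    · exact (HodgeStructure.piece_le_F _ _ _).trans (by rw [F_eq_bot_of_lt hX (by omega)]; exact bot_le)

/-- **`H^{2,0}(X) = 0` ⟹ `N¹H²(X) = H²(X(ℂ); ℂ)`**: every rational class is then of type `(1,1)`, hence
algebraic (Lefschetz `(1,1)`), and the rational classes span. [cite: VoisinHodgeI2002, Thm. 11.30] -/
theorem algebraicClasses_eq_top_of_forall (hX : IsSmoothProjective n X)
    (h : ∀ c : complexBetti X (2 * 1), IsOfHodgeType n X (2 * 1) 2 0 c → c = 0) :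
    algebraicClasses X 1 = ⊤ := by
  refine eq_top_iff.2 ?_
  rw [← span_isRationalClass_eq_top_of_isSmoothProjective_holds n X hX (2 * 1), Submodule.span_le]
  intro c hc
  exact lefschetzOneOne_rational_holds hX c hc (isOfHodgeType_one_one_of_forall hX h c)

/-- **`ρ(X) < b₂(X)` ⟹ there is a nonzero class of type `(2,0)`** (`h^{2,0}(X) ≥ 1`, model-free).
[cite: VoisinHodgeI2002, §6.1.3 and Thm. 11.30] -/
theorem exists_twoZero_of_finrank_lt (hX : IsSmoothProjective n X)
    (hlt : Module.finrank ℂ (algebraicClasses X 1) < Module.finrank ℂ (complexBetti X (2 * 1))) :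
    ∃ σ₀ : complexBetti X (2 * 1), IsOfHodgeType n X (2 * 1) 2 0 σ₀ ∧ σ₀ ≠ 0 := by
  by_contra! h
  refine hlt.ne ?_
  rw [algebraicClasses_eq_top_of_forall hX h, finrank_top]

end AnyDim

/-! ## §2 Transfer along `ι : Y ⟶ M` with `ι^*` bijective on `H²(–(ℂ); ℂ)` -/

section Transfer

variable {n m : ℕ} {Y M : SchemeOver ℂ}

/-- `ι^* : H²_B(M) → H²_B(Y)` is a morphism of `ℚ`-Hodge structures (tree `BettiUniverse.pullHodgeHom`, weight
re-typed). [cite: VoisinHodgeI2002, §7.3.2] -/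
def pullHom (hY : IsSmoothProjective n Y) (hM : IsSmoothProjective m M) (ι : Y ⟶ M) : Hom (H2n hM) (H2n hY) where
  toLinearMap := BettiUniverse.pull ι (2 * 1)
  map_F_le := (BettiUniverse.pullHodgeHom exists_isReal_hodgeModel_holds hodgePQ_independent_of_hodgeModel_holds
    hY hM ι (2 * 1)).map_F_le

/-- `pullHom` is `ι^*` on vectors. [cite: VoisinHodgeI2002, §7.3.2] -/
@[simp] theorem pullHom_toLinearMap (hY : IsSmoothProjective n Y) (hM : IsSmoothProjective m M) (ι : Y ⟶ M) :
    (pullHom hY hM ι).toLinearMap = BettiUniverse.pull ι (2 * 1) := rfl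

/-- `ι^* ∘ Θ_M = Θ_Y ∘ (ι^*_ℚ ⊗ 1)`. [cite: HatcherAT2002, §3.1 p. 198] -/
theorem map_theta (ι : Y ⟶ M) (t : ℂ ⊗[ℚ] bettiCohomology M (2 * 1)) :
    complexBetti.map ι (2 * 1) (ofRatClassBaseChange (Motives.ComplexPoints M) (2 * 1) t) = ofRatClassBaseChange (Motives.ComplexPoints Y) (2 * 1) ((BettiUniverse.pull ι (2 * 1)).baseChange ℂ t) :=
  map_ofRatClassBaseChange (Motives.ComplexPoints M) (2 * 1) (Motives.AlgPoints.mapContinuous (L := ℂ) ι) t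

/-- `ι^* (v ⊗ 1) = (ι^*_ℚ v) ⊗ 1`. [cite: HatcherAT2002, §3.1 p. 198] -/
theorem map_ofRatClass (ι : Y ⟶ M) (v : bettiCohomology M (2 * 1)) :
    complexBetti.map ι (2 * 1) (ofRatClass (Motives.ComplexPoints M) (2 * 1) v) =
      ofRatClass (Motives.ComplexPoints Y) (2 * 1) (BettiUniverse.pull ι (2 * 1) v) :=
  (Motives.ofRatClass_map (2 * 1) (Motives.AlgPoints.mapContinuous (L := ℂ) ι) v).symm

/-- `ι^*` injective on `H²(–; ℂ)` ⟹ injective on `H²(–; ℚ)` (`H²(–; ℂ) = H²(–; ℚ) ⊗ ℂ`). [cite: HatcherAT2002, §3.1 p. 198] -/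
theorem pull_injective (ι : Y ⟶ M) (hinj : Function.Injective (complexBetti.map ι (2 * 1))) :
    Function.Injective (BettiUniverse.pull ι (2 * 1)) := by
  intro v w h
  apply ofRatClass_injective (Y := Motives.ComplexPoints M) (2 * 1)
  apply hinj
  rw [map_ofRatClass, map_ofRatClass, h]

/-- `b₂`: `dim_ℚ H²(X(ℂ); ℚ) = dim_ℂ H²(X(ℂ); ℂ)`. [cite: VoisinHodgeI2002, §7.1.1] -/
theorem finrank_betti_eq {k : ℕ} {X : SchemeOver ℂ} (hX : IsSmoothProjective k X) :
    Module.finrank ℚ (bettiCohomology X (2 * 1)) = Module.finrank ℂ (complexBetti X (2 * 1)) := by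
  rw [← (ofRatClassBaseChangeEquiv hX (2 * 1)).finrank_eq, Module.finrank_baseChange]

/-- **`ι^*` bijective on `H²(–; ℂ)` ⟹ bijective on `H²(–; ℚ)`** (injective, and the `ℚ`-dimensions agree).
[cite: VoisinHodgeII2003, Thm. 1.23] -/
theorem pull_bijective (hY : IsSmoothProjective n Y) (hM : IsSmoothProjective m M) (ι : Y ⟶ M)
    (hbij : Function.Bijective (complexBetti.map ι (2 * 1))) :
    Function.Bijective (BettiUniverse.pull ι (2 * 1)) := by
  haveI := BettiUniverse.finite hM (2 * 1)
  haveI := BettiUniverse.finite hY (2 * 1)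
  have hinj := pull_injective ι hbij.1
  have hfin : Module.finrank ℚ (bettiCohomology M (2 * 1)) = Module.finrank ℚ (bettiCohomology Y (2 * 1)) := by
    rw [finrank_betti_eq hM, finrank_betti_eq hY]
    exact ((LinearEquiv.ofBijective (complexBetti.map ι (2 * 1)).hom hbij).finrank_eq)
  exact ⟨hinj, (LinearMap.injective_iff_surjective_of_finrank_eq_finrank hfin).1 hinj⟩

/-- `b₂(Y) = b₂(M)`. [cite: VoisinHodgeII2003, Thm. 1.23] -/
theorem finrank_complexBetti_eq (ι : Y ⟶ M) (hbij : Function.Bijective (complexBetti.map ι (2 * 1))) :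
    Module.finrank ℂ (complexBetti Y (2 * 1)) = Module.finrank ℂ (complexBetti M (2 * 1)) :=
  ((LinearEquiv.ofBijective (complexBetti.map ι (2 * 1)).hom hbij).finrank_eq).symm

/-- **`(ι^*)⁻¹ : H²_B(Y) → H²_B(M)` is a morphism of Hodge structures** — a bijective morphism of `ℚ`-Hodge
structures is an isomorphism (strictness; tree `Hom.inverse`). [cite: VoisinHodgeI2002, §7.3.1 Lemma 7.23] -/
def invHom (hY : IsSmoothProjective n Y) (hM : IsSmoothProjective m M) (ι : Y ⟶ M)
    (hbij : Function.Bijective (complexBetti.map ι (2 * 1))) : Hom (H2n hY) (H2n hM) :=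
  (pullHom hY hM ι).inverse (pull_bijective hY hM ι hbij)

/-- `ι^* ∘ (ι^*)⁻¹ = id`. [cite: VoisinHodgeI2002, §7.3.1 Lemma 7.23] -/
theorem pull_invHom_apply (hY : IsSmoothProjective n Y) (hM : IsSmoothProjective m M) (ι : Y ⟶ M)
    (hbij : Function.Bijective (complexBetti.map ι (2 * 1))) (w : bettiCohomology Y (2 * 1)) :
    BettiUniverse.pull ι (2 * 1) ((invHom hY hM ι hbij).toLinearMap w) = w :=
  (pullHom hY hM ι).apply_inverse_apply (pull_bijective hY hM ι hbij) w

/-- `(ι^*)⁻¹ ∘ ι^* = id`. [cite: VoisinHodgeI2002, §7.3.1 Lemma 7.23] -/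
theorem invHom_pull_apply (hY : IsSmoothProjective n Y) (hM : IsSmoothProjective m M) (ι : Y ⟶ M)
    (hbij : Function.Bijective (complexBetti.map ι (2 * 1))) (v : bettiCohomology M (2 * 1)) :
    (invHom hY hM ι hbij).toLinearMap (BettiUniverse.pull ι (2 * 1) v) = v :=
  (pullHom hY hM ι).inverse_apply_apply (pull_bijective hY hM ι hbij) v

/-- `(ι^*_ℚ ⊗ 1) ∘ ((ι^*)⁻¹ ⊗ 1) = id`. [cite: VoisinHodgeI2002, §7.3.1 Lemma 7.23] -/
theorem pull_baseChange_invHom_baseChange (hY : IsSmoothProjective n Y) (hM : IsSmoothProjective m M) (ι : Y ⟶ M)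
    (hbij : Function.Bijective (complexBetti.map ι (2 * 1))) (x : ℂ ⊗[ℚ] bettiCohomology Y (2 * 1)) :
    (BettiUniverse.pull ι (2 * 1)).baseChange ℂ (((invHom hY hM ι hbij).toLinearMap).baseChange ℂ x) = x := by
  have hcomp : BettiUniverse.pull ι (2 * 1) ∘ₗ (invHom hY hM ι hbij).toLinearMap = LinearMap.id :=
    LinearMap.ext fun w ↦ pull_invHom_apply hY hM ι hbij w
  rw [← LinearMap.comp_apply, ← LinearMap.baseChange_comp, hcomp, LinearMap.baseChange_id, LinearMap.id_apply]

/-- **Hodge types LIFT along `ι^*`**: a class of type `(p,q)` on `Y` (`p + q = 2`) is `ι^*` of a class of type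
`(p,q)` on `M`. [cite: VoisinHodgeI2002, §7.3.1 Lemma 7.23 and §7.3.2] -/
theorem exists_preimage_isOfHodgeType (hY : IsSmoothProjective n Y) (hM : IsSmoothProjective m M) (ι : Y ⟶ M)
    (hbij : Function.Bijective (complexBetti.map ι (2 * 1))) {p q : ℕ} (hpq : p + q = 2)
    {c : complexBetti Y (2 * 1)} (hc : IsOfHodgeType n Y (2 * 1) p q c) :
    ∃ c' : complexBetti M (2 * 1), IsOfHodgeType m M (2 * 1) p q c' ∧ complexBetti.map ι (2 * 1) c' = c := by
  obtain ⟨x, rfl⟩ := ofRatClassBaseChange_surjective hY (2 * 1) c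
  refine ⟨ofRatClassBaseChange (Motives.ComplexPoints M) (2 * 1) (((invHom hY hM ι hbij).toLinearMap).baseChange ℂ x), ?_, ?_⟩
  · rw [← mem_piece_iff hM hpq]
    exact (invHom hY hM ι hbij).map_piece_le p q ⟨x, (mem_piece_iff hY hpq x).2 hc, rfl⟩
  · rw [map_theta, pull_baseChange_invHom_baseChange]

/-- **Hodge types DESCEND along `ι^*` on rational vectors**: if `(ι^*_ℚ v) ⊗ 1` is of type `(p,q)` on `Y`, then
`v ⊗ 1` is of type `(p,q)` on `M`. [cite: VoisinHodgeI2002, §7.3.1 Lemma 7.23] -/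
theorem isOfHodgeType_of_pull (hY : IsSmoothProjective n Y) (hM : IsSmoothProjective m M) (ι : Y ⟶ M)
    (hbij : Function.Bijective (complexBetti.map ι (2 * 1))) {p q : ℕ} (hpq : p + q = 2)
    {v : bettiCohomology M (2 * 1)}
    (h : IsOfHodgeType n Y (2 * 1) p q
      (ofRatClass (Motives.ComplexPoints Y) (2 * 1) (BettiUniverse.pull ι (2 * 1) v))) :
    IsOfHodgeType m M (2 * 1) p q (ofRatClass (Motives.ComplexPoints M) (2 * 1) v) := by
  have h1 : ((1 : ℂ) ⊗ₜ[ℚ] BettiUniverse.pull ι (2 * 1) v) ∈ (H2n hY).piece p q := by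
    rw [mem_piece_iff hY hpq, ofRatClassBaseChange_tmul, one_smul]
    exact h
  have h2 := (invHom hY hM ι hbij).map_piece_le p q ⟨_, h1, rfl⟩
  rw [LinearMap.baseChange_tmul, invHom_pull_apply] at h2
  rw [← one_smul ℂ (ofRatClass (Motives.ComplexPoints M) (2 * 1) v), ← ofRatClassBaseChange_tmul]
  exact (mem_piece_iff hM hpq _).1 h2

/-- **`ι^* N¹H²(M) ⊆ N¹H²(Y)`** — no bijectivity needed: `N¹` is spanned by rational `(1,1)`-classes, whose
pull-backs are rational `(1,1)`, hence algebraic by Lefschetz `(1,1)` on `Y`.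
[cite: VoisinHodgeI2002, Thm. 11.30] [cite: GrothendieckTopology1969, pp. 299–300] -/
theorem map_algebraicClasses_le (hY : IsSmoothProjective n Y) (hM : IsSmoothProjective m M) (ι : Y ⟶ M) :
    (algebraicClasses M 1).map (complexBetti.map ι (2 * 1)).hom ≤ algebraicClasses Y 1 := by
  change (supportedClasses M (2 * 1) 1).map _ ≤ _
  rw [supportedClasses_eq_span_isRationalClass hM (2 * 1) 1, Submodule.map_span_le]
  rintro c ⟨hcQ, hcN⟩
  exact lefschetzOneOne_rational_holds hY _ (hcQ.map _)
    ((isOfHodgeType_of_mem_algebraicClasses_of_isSmoothProjective hM 1 hcN).map_of_isSmoothProjective hY hM ι)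

/-- **`N¹H²(Y) ⊆ ι^* N¹H²(M)`** when `ι^*` is bijective on `H²`: a rational algebraic class of `Y` is `ι^*` of a
rational class of `M` (`ℚ`-bijectivity) of type `(1,1)` (types descend), hence algebraic (Lefschetz `(1,1)` on
`M`). [cite: VoisinHodgeI2002, Thm. 11.30 and Lemma 7.23] -/
theorem algebraicClasses_le_map (hY : IsSmoothProjective n Y) (hM : IsSmoothProjective m M) (ι : Y ⟶ M)
    (hbij : Function.Bijective (complexBetti.map ι (2 * 1))) :
    algebraicClasses Y 1 ≤ (algebraicClasses M 1).map (complexBetti.map ι (2 * 1)).hom := by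
  change supportedClasses Y (2 * 1) 1 ≤ _
  rw [supportedClasses_eq_span_isRationalClass hY (2 * 1) 1, Submodule.span_le]
  rintro c ⟨hcQ, hcN⟩
  obtain ⟨w, rfl⟩ := (isRationalClass_iff_mem_range_ofRatClass c).1 hcQ
  obtain ⟨v, rfl⟩ := (pull_bijective hY hM ι hbij).2 w
  have h11 : IsOfHodgeType m M (2 * 1) 1 1 (ofRatClass (Motives.ComplexPoints M) (2 * 1) v) :=
    isOfHodgeType_of_pull hY hM ι hbij rfl (isOfHodgeType_of_mem_algebraicClasses_of_isSmoothProjective hY 1 hcN)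
  exact ⟨ofRatClass (Motives.ComplexPoints M) (2 * 1) v,
    lefschetzOneOne_rational_holds hM _ (isRationalClass_ofRatClass v) h11, map_ofRatClass ι v⟩

/-- **`N¹H²(Y) = ι^* N¹H²(M)`.** [cite: VoisinHodgeI2002, Thm. 11.30] -/
theorem map_algebraicClasses_eq (hY : IsSmoothProjective n Y) (hM : IsSmoothProjective m M) (ι : Y ⟶ M)
    (hbij : Function.Bijective (complexBetti.map ι (2 * 1))) :
    (algebraicClasses M 1).map (complexBetti.map ι (2 * 1)).hom = algebraicClasses Y 1 :=
  le_antisymm (map_algebraicClasses_le hY hM ι) (algebraicClasses_le_map hY hM ι hbij)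

/-- **`ρ(Y) = ρ(M)`.** [cite: VoisinHodgeI2002, Thm. 11.30] [cite: VoisinHodgeII2003, Thm. 1.23] -/
theorem finrank_algebraicClasses_eq (hY : IsSmoothProjective n Y) (hM : IsSmoothProjective m M) (ι : Y ⟶ M)
    (hbij : Function.Bijective (complexBetti.map ι (2 * 1))) :
    Module.finrank ℂ (algebraicClasses Y 1) = Module.finrank ℂ (algebraicClasses M 1) := by
  rw [← map_algebraicClasses_eq hY hM ι hbij]
  exact ((Submodule.equivMapOfInjective _ hbij.1 (algebraicClasses M 1)).finrank_eq).symm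

/-- **The `(2,0)`-LINE TRANSFERS**: if the `(2,0)`-classes of `M` form the line `ℂσ₀ ≠ 0`, those of `Y` form the
line `ℂ ι^*σ₀ ≠ 0`. [cite: VoisinHodgeI2002, §7.3.2 and Lemma 7.23] -/
theorem twoZero_transfer (hY : IsSmoothProjective n Y) (hM : IsSmoothProjective m M) (ι : Y ⟶ M)
    (hbij : Function.Bijective (complexBetti.map ι (2 * 1))) {σ₀ : complexBetti M (2 * 1)}
    (hσ₀ : IsOfHodgeType m M (2 * 1) 2 0 σ₀) (hσ₀0 : σ₀ ≠ 0)
    (hline : ∀ c : complexBetti M (2 * 1), IsOfHodgeType m M (2 * 1) 2 0 c → ∃ t : ℂ, c = t • σ₀) :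
    IsOfHodgeType n Y (2 * 1) 2 0 (complexBetti.map ι (2 * 1) σ₀) ∧ complexBetti.map ι (2 * 1) σ₀ ≠ 0 ∧
      ∀ c : complexBetti Y (2 * 1), IsOfHodgeType n Y (2 * 1) 2 0 c →
        ∃ t : ℂ, c = t • complexBetti.map ι (2 * 1) σ₀ := by
  refine ⟨hσ₀.map_of_isSmoothProjective hY hM ι, fun h ↦ hσ₀0 (hbij.1 (by rw [h, map_zero])), fun c hc ↦ ?_⟩
  obtain ⟨c', hc', rfl⟩ := exists_preimage_isOfHodgeType hY hM ι hbij rfl hc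
  obtain ⟨t, rfl⟩ := hline c' hc'
  exact ⟨t, map_smul _ _ _⟩

end Transfer

/-! ## §3 Automorphism transfer: `τ ≫ ι = ι ≫ σ` -/

section Auto

variable {Y M : SchemeOver ℂ} (ι : Y ⟶ M) {σ : M ⟶ M} {τ : Y ⟶ Y}

/-- `τ^* ι^* = ι^* σ^*` on `Hᵏ(–(ℂ); ℂ)`. [cite: FultonYoungTableaux1997, Appendix B §B.1 (1)] -/
theorem map_map_of_comm (hcomm : τ ≫ ι = ι ≫ σ) {k : ℕ} (c : complexBetti M k) :
    complexBetti.map τ k (complexBetti.map ι k c) = complexBetti.map ι k (complexBetti.map σ k c) := by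
  rw [← CategoryTheory.comp_apply, ← complexBetti.map_comp, hcomm, complexBetti.map_comp,
    CategoryTheory.comp_apply]

/-- `σ^*` moves `c` and `ι^*` is injective ⟹ `τ^*` moves `ι^* c`. [cite: VoisinHodgeII2003, §2.3.1] -/
theorem map_ne_of_comm (hcomm : τ ≫ ι = ι ≫ σ) {k : ℕ} (hinj : Function.Injective (complexBetti.map ι k))
    {c : complexBetti M k} (hmove : complexBetti.map σ k c ≠ c) :
    (complexBetti.map τ k).hom (complexBetti.map ι k c) ≠ complexBetti.map ι k c := by
  intro h
  apply hmove
  apply hinj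
  rw [← map_map_of_comm ι hcomm]
  exact h

/-- `σ^*c = ζc` ⟹ `τ^*(ι^*c) = ζ·ι^*c` (eigen-relations transfer). [cite: VoisinHodgeII2003, §2.3.1] -/
theorem map_eq_smul_of_comm (hcomm : τ ≫ ι = ι ≫ σ) {k : ℕ} {c : complexBetti M k} {ζ : ℂ}
    (hact : complexBetti.map σ k c = ζ • c) :
    (complexBetti.map τ k).hom (complexBetti.map ι k c) = ζ • complexBetti.map ι k c := by
  show complexBetti.map τ k (complexBetti.map ι k c) = _
  rw [map_map_of_comm ι hcomm, hact, map_smul]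

/-- `σ^*c = ζc` ⟹ `(σ^d)^*c = ζ^d c` (powers in the monoid `End X`). [cite: VoisinHodgeII2003, §2.3.1] -/
theorem map_pow_apply_of_smul {X : SchemeOver ℂ} {σ : X ⟶ X} {k : ℕ} {c : complexBetti X k} {ζ : ℂ}
    (hact : complexBetti.map σ k c = ζ • c) (d : ℕ) :
    complexBetti.map (CategoryTheory.End.of σ ^ d : CategoryTheory.End X) k c = ζ ^ d • c := by
  have hact' : complexBetti.map (CategoryTheory.End.of σ) k c = ζ • c := hact
  induction d with
  | zero =>
    rw [pow_zero, pow_zero, one_smul, CategoryTheory.End.one_def, complexBetti.map_id]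
    rfl
  | succ d ih =>
    rw [pow_succ, CategoryTheory.End.mul_def, complexBetti.map_comp, CategoryTheory.comp_apply, ih, map_smul,
      hact', smul_smul, ← pow_succ]

/-- `τ^k ≫ ι = ι ≫ σ^k` (powers in the monoids `End Y`, `End M`). [cite: VoisinHodgeII2003, §2.3.1] -/
theorem pow_comp_eq (hcomm : τ ≫ ι = ι ≫ σ) (k : ℕ) :
    (CategoryTheory.End.of τ ^ k : CategoryTheory.End Y) ≫ ι =
      ι ≫ (CategoryTheory.End.of σ ^ k : CategoryTheory.End M) := by
  induction k with
  | zero => rw [pow_zero, pow_zero, CategoryTheory.End.one_def, CategoryTheory.End.one_def,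
      Category.id_comp, Category.comp_id]
  | succ k ih =>
    rw [pow_succ, pow_succ, CategoryTheory.End.mul_def, CategoryTheory.End.mul_def, Category.assoc, ih,
      ← Category.assoc, show (CategoryTheory.End.of τ : Y ⟶ Y) ≫ ι = ι ≫ σ from hcomm, Category.assoc]

/-- **`ι` mono, `σ^k = 𝟙`, `τ ≫ ι = ι ≫ σ` ⟹ `τ^k = 𝟙`** (the restriction of `σ` to a stable subvariety has
order dividing `k`). [cite: VoisinHodgeII2003, §2.3.1] -/
theorem pow_eq_one_of_comm [Mono ι] (hcomm : τ ≫ ι = ι ≫ σ) {k : ℕ} (hσ : CategoryTheory.End.of σ ^ k = 1) :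
    CategoryTheory.End.of τ ^ k = 1 := by
  have h := pow_comp_eq ι hcomm k
  rw [hσ, CategoryTheory.End.one_def, Category.comp_id] at h
  exact (cancel_mono ι).1 (h.trans (Category.id_comp ι).symm)

end Auto

/-! ## §4 The kernel inputs for `Y`, from data on `M` -/

section Kernel

variable {n m : ℕ} {Y M : SchemeOver ℂ}

/-- **KERNEL INPUTS.** For `ι : Y ⟶ M` of smooth projective varieties with `ι^*` bijective on `H²(–; ℂ)`, a class
`σ₀ ≠ 0` spanning the `(2,0)`-classes of `M`, `σ : M ⟶ M` moving `σ₀`, `τ : Y ⟶ Y` over `σ`, and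
`p − 1 = b₂(M) − ρ(M)`: the class `ι^*σ₀` spans the `(2,0)`-classes of `Y`, is nonzero, is moved by `τ^*`, and
`p − 1 = b₂(Y) − ρ(Y)` — exactly the hypotheses of the cell kernel theorem («E_X» for threefolds of prime order) for
`Y` (besides `dim Y = 3`, `τ^p = 𝟙`; cell hodge-nonav, route memo ROUTE-P1Y/P1Z). [cite: VoisinHodgeII2003, Thm. 1.23] [cite: VoisinHodgeI2002, Lemma 7.23, Thm. 11.30] -/
theorem kernelInputs (hY : IsSmoothProjective n Y) (hM : IsSmoothProjective m M) (ι : Y ⟶ M)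
    (hbij : Function.Bijective (complexBetti.map ι (2 * 1))) {σ₀ : complexBetti M (2 * 1)}
    (hσ₀ : IsOfHodgeType m M (2 * 1) 2 0 σ₀) (hσ₀0 : σ₀ ≠ 0)
    (hline : ∀ c : complexBetti M (2 * 1), IsOfHodgeType m M (2 * 1) 2 0 c → ∃ t : ℂ, c = t • σ₀)
    {σ : M ⟶ M} {τ : Y ⟶ Y} (hcomm : τ ≫ ι = ι ≫ σ) (hmove : complexBetti.map σ (2 * 1) σ₀ ≠ σ₀) {p : ℕ}
    (hrank : p - 1 = Module.finrank ℂ (complexBetti M (2 * 1)) - Module.finrank ℂ (algebraicClasses M 1)) :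
    IsOfHodgeType n Y (2 * 1) 2 0 (complexBetti.map ι (2 * 1) σ₀) ∧ complexBetti.map ι (2 * 1) σ₀ ≠ 0 ∧
      (∀ c : complexBetti Y (2 * 1), IsOfHodgeType n Y (2 * 1) 2 0 c →
        ∃ t : ℂ, c = t • complexBetti.map ι (2 * 1) σ₀) ∧
      (complexBetti.map τ (2 * 1)).hom (complexBetti.map ι (2 * 1) σ₀) ≠ complexBetti.map ι (2 * 1) σ₀ ∧
      p - 1 = Module.finrank ℂ (complexBetti Y (2 * 1)) - Module.finrank ℂ (algebraicClasses Y 1) := by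
  obtain ⟨h1, h2, h3⟩ := twoZero_transfer hY hM ι hbij hσ₀ hσ₀0 hline
  exact ⟨h1, h2, h3, map_ne_of_comm ι hcomm hbij.1 hmove,
    by rw [finrank_complexBetti_eq ι hbij, finrank_algebraicClasses_eq hY hM ι hbij, hrank]⟩

end Kernel

end Literature.AlgebraicGeometry.HodgeTheory.H2Transfer

end
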